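import Summits.ABC.IUTFork.Conditional.AbcOfSHwindowFreyRefutationWindow
import Summits.ABC.IUTFork.Conditional.AbcOfSHwindowFreyRefutationApex
import Summits.ABC.IUTFork.Conditional.AbcOfSHwindowFreyRefutationAdmissible
import Summits.ABC.IUTFork.Conditional.AbcOfSGenuineKLinUniformRows2
import HarnessLib

/-!
# R-W task «C:HSHW-REF», tier 2, prime `p = 167`: at the known abc triple `3·5⁶·7⁸·53 + 167⁹ = 2·11⁶·193⁴·20551` and `l ∈ {7, 11, 13}`
# the binder `hSHwBad` of the cut certificate of record (p453137) is FALSE — modulo (P6) at the point, a named hypothesis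

PROOF-ONLY file (no `def`, no new `Prop`, no instance, no notation) of the abc-iut cell (seat abc-iut-W-ref-3, gen 0; R-W row «C:HSHW-REF tier-2/3»,
abc-iut-w6-d102's second, files disjoint by prime: THIS file is the prime `167` — C-R39a's «[ED] route» target; R-W numerics lead's rows
`pilotDataOfK:frey-14321927484375-…:7`, `…:11`, `…:13` of HOME/plan/rescue/R-W/TARGETS.tsv (ranks 5, 15, 25; `v_167(abc) = 9`), Szpiro margins
−6.85 / −30.99 / −48.20). TAKES NO SIDE on [IUTchIII] Cor. 3.12 or on any author.

Inputs, all BY NAME: (S) ¬S_H at every genuine Θ-volume datum over `(ratPoint (a/c), l)`, `l ∈ {7, 11, 13}` — abc-iut-w5-d107's UNCONDITIONAL [LIN] row theorem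
`GenuineK.not_pilotKummerCompatHull_chosen_frey14321927484375` (explicit depth at the TAME place over `167`, `v = 9`, local type `e ∣ 30·l`; the same route as
kit part 2 `FreyRef.not_pilotKummerCompatHull_chosen_triple_of_explicitDepth` with `e ∣ 60·l`, `k = 1`: `7·1489 < 9·8·165`, `11·2151 < 9·24·165`,
`13·2482 < 9·35·165`); the dictionary of `j(a/c)` (§1: `I = {3, 5, 7, 11, 53, 167, 193, 20551}`, `e = (2, 12, 16, 12, 2, 18, 8, 2)`, `2 ∉ I` since `v_2(abc) = 1`
gives `ord_2 j = +6`; abc-iut-c312-d1's `Corollary22RatPointDictionary`); admissibility §2 (kit part 4); the Szpiro-bad guard §3 (kit part 1; certificates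
`(A, B, n) = (20, 35, 3)` at the TIGHT row `l = 7` — exact exponents `288/44`, `504/44` scaled by `n = 3` and rounded up — and `(6, 9, 1)` at `l = 11, 13`);
window membership §4 (kit part 1 v2: every local height is `≤ 18`; `8·18 ≤ 238`, `24·18 ≤ 550`, `35·18 ≤ 754`); the apex §5 (kit part 3).
(P6) = `Cor22.CondP6` at `(ratPoint (a/c), l)` is a HYPOTHESIS (an existing definition, not decided in the tree at explicit points).

HONEST SCOPE: SHARP reading; per-label licence STRONGER than print; nothing about the printed GLOBAL inequality, the number-level Corollary
(`hNumBad`), the θ-cut record (p460293) or any author's intended hull; «refuted as typed» ≠ «refuted in print»; typed ≠ proved; instantiated ≠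
endorsed; no abc claim. [cite: Mochizuki2012, IUTchIII Cor. 3.12 p. 173–174, Step (xi-f) p. 184; IUTchIV Thm. 1.10 p. 22–23, Cor. 2.2 (ii) proof p. 44–46]
[cite: MochizukiGenEll2010, Def. 3.3 p. 12] [cite: DupuyHilado2025, §3.4] [claim: Mochizuki2012, status: disputed] for every IUT sentence quoted.
-/

noncomputable section

open Set Function NumberField IsDedekindDomain

namespace Summit.ABC.IUTFork.Conditional

open Thm311 Thm311.Real Cor312 Cor312Vol Cor312Prov Literature.IUT.LogThetaLattice Literature.IUT.LogVolume
  Literature.IUT.HodgeTheaters Literature.IUT.LogVolume.ThetaData Literature.IUT.LogVolume.Cor22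
open Literature.NumberTheory.NumberFields Literature.NumberTheory.GaloisRepresentations.Ultrametric
open Literature.NumberTheory.DiophantineGeometry Literature.NumberTheory.DiophantineGeometry.GenEll Summit.ABC.ABC.Theorems

namespace FreyRef

/-! ## §1. The dictionary of `j(a/c)`, `a/c = 3·5⁶·7⁸·53 / 2·11⁶·193⁴·20551` -/

/-- **`j(a/c) = N/D`**, `N = 2⁶·(a² + ab + b²)³`, `D = (abc)²/2² = 3²·5¹²·7¹⁶·11¹²·53²·167¹⁸·193⁸·20551²` (the Frey formula `j = 2⁸(a²−ac+c²)³/(abc)²` with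
`v_2(abc) = 1`: the place over `2` is NOT a pole). [cite: MochizukiGenEll2010, Def. 3.3 p. 12] -/
theorem frey167_jInv : Cor22.jInv (((3 * 5 ^ 6 * 7 ^ 8 * 53 : ℕ) : ℚ) / (2 * 11 ^ 6 * 193 ^ 4 * 20551 : ℕ)) =
    ((68056498456556207915160051535905509335505775495096996305117608163402683505885574664074686956393690114695790923475385419456 : ℕ) : ℚ) /
      ((5342395476888840192907445285862231764167911589503175915868759790504966373935579263580951854225246337890625 : ℕ) : ℚ) := by
  norm_num [Cor22.jInv]

/-- The primes of `I`. [folklore] -/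
theorem frey167_primes : ∀ p ∈ ({3, 5, 7, 11, 53, 167, 193, 20551} : Finset ℕ), p.Prime := by
  intro p hp
  simp only [Finset.mem_insert, Finset.mem_singleton] at hp
  rcases hp with rfl | rfl | rfl | rfl | rfl | rfl | rfl | rfl <;> norm_num

/-- The exponents are `≥ 1`. [folklore] -/
theorem frey167_exp_ne_zero : ∀ p ∈ ({3, 5, 7, 11, 53, 167, 193, 20551} : Finset ℕ),
    (fun p : ℕ => if p = 5 then 12 else if p = 7 then 16 else if p = 11 then 12 else if p = 167 then 18 else if p = 193 then 8 else 2) p ≠ 0 := by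
  intro p _
  dsimp only
  split_ifs <;> decide

/-- `D = ∏_{p ∈ I} p^{e_p}`. [folklore] -/
theorem frey167_D :
    (5342395476888840192907445285862231764167911589503175915868759790504966373935579263580951854225246337890625 : ℕ) =
    ∏ p ∈ ({3, 5, 7, 11, 53, 167, 193, 20551} : Finset ℕ), p ^ (fun p : ℕ => if p = 5 then 12 else if p = 7 then 16 else if p = 11 then 12 else if p = 167 then 18 else if p = 193 then 8 else 2) p := by
  norm_num

/-- `p ∤ N` for `p ∈ I`. [folklore] -/
theorem frey167_coprime : ∀ p ∈ ({3, 5, 7, 11, 53, 167, 193, 20551} : Finset ℕ),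
    ¬ p ∣ (68056498456556207915160051535905509335505775495096996305117608163402683505885574664074686956393690114695790923475385419456 : ℕ) := by
  intro p hp
  simp only [Finset.mem_insert, Finset.mem_singleton] at hp
  rcases hp with rfl | rfl | rfl | rfl | rfl | rfl | rfl | rfl <;> norm_num

/-- `N ≠ 0`. [folklore] -/
theorem frey167_N_ne_zero :
    (68056498456556207915160051535905509335505775495096996305117608163402683505885574664074686956393690114695790923475385419456 : ℕ) ≠ 0 := by
  norm_num

/-! ## §2. Admissibility of `(ratPoint (a/c), l)`: `U_P`, `AdmitsCore`, (P2), (P5) -/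

/-- `ratPoint (a/c) ∈ U_P`. [cite: MochizukiGenEll2010, Ex. 1.3 (i) p. 5] -/
theorem frey167_mem_UP : ratPoint (((3 * 5 ^ 6 * 7 ^ 8 * 53 : ℕ) : ℚ) / (2 * 11 ^ 6 * 193 ^ 4 * 20551 : ℕ)) ∈ UP :=
  ratPoint_triple_mem_UP isABCTriple_frey14321927484375

/-- **`AdmitsCore`**: `j(a/c)` is none of `2¹⁴31³/5³`, `2²73³/3⁴`, `1728`, `0` (its denominator carries `167¹⁸`).
[cite: Mochizuki2012, IUTchIV Cor. 2.2 (ii) proof p. 43] [claim: Mochizuki2012, status: disputed] -/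
theorem frey167_admitsCore : Cor22.AdmitsCore (ratPoint (((3 * 5 ^ 6 * 7 ^ 8 * 53 : ℕ) : ℚ) / (2 * 11 ^ 6 * 193 ^ 4 * 20551 : ℕ))) := by
  intro r hr
  change Cor22.jInv (((3 * 5 ^ 6 * 7 ^ 8 * 53 : ℕ) : ℚ) / (2 * 11 ^ 6 * 193 ^ 4 * 20551 : ℕ)) ≠ (r : ℚ)
  rw [frey167_jInv]
  simp only [Cor22.coreExceptionalJ, Finset.mem_insert, Finset.mem_singleton] at hr
  rcases hr with rfl | rfl | rfl | rfl <;> norm_num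

/-- **(P2)** at `l ∈ {7, 11, 13}`: no exponent `e_p` is divisible by `7`, `11` or `13`. [cite: Mochizuki2012, IUTchIV Cor. 2.2 (ii) proof (P2) p. 45]
[claim: Mochizuki2012, status: disputed] -/
theorem frey167_condP2 {l : ℕ} (hl : l = 7 ∨ l = 11 ∨ l = 13) : Cor22.CondP2 (ratPoint (((3 * 5 ^ 6 * 7 ^ 8 * 53 : ℕ) : ℚ) / (2 * 11 ^ 6 * 193 ^ 4 * 20551 : ℕ))) l := by
  refine condP2_ratPoint_of_dictionary frey167_primes frey167_exp_ne_zero frey167_D frey167_jInv frey167_N_ne_zero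
    frey167_coprime fun p hp => ?_
  simp only [Finset.mem_insert, Finset.mem_singleton] at hp
  rcases hl with rfl | rfl | rfl <;> rcases hp with rfl | rfl | rfl | rfl | rfl | rfl | rfl | rfl <;> norm_num

/-- **(P5)** at any prime `l ≠ 167`: the place over `167` is bad and divides neither `2` nor `l`. [cite: Mochizuki2012, IUTchIV Cor. 2.2 (ii) proof (P5) p. 46]
[claim: Mochizuki2012, status: disputed] -/
theorem frey167_condP5 {l : ℕ} (hl : l.Prime) (hne : 167 ≠ l) : Cor22.CondP5 (ratPoint (((3 * 5 ^ 6 * 7 ^ 8 * 53 : ℕ) : ℚ) / (2 * 11 ^ 6 * 193 ^ 4 * 20551 : ℕ))) l :=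
  condP5_ratPoint_of_dictionary frey167_primes frey167_exp_ne_zero frey167_D frey167_jInv frey167_N_ne_zero frey167_coprime
    hl (p₀ := 167) (by simp) (by norm_num) hne

/-! ## §3. The Szpiro-bad guard at `l = 7` (tight: margin −6.85), `11`, `13` (integer certificates) -/

/-- **Szpiro-bad at `l = 7`**: `J = I ∖ {2, 7}`, `A = 20`, `B = 35`, `n = 3` (R-W margin −6.85). [cite: Mochizuki2012, IUTchIV Thm. 1.10 p. 22–23]
[claim: Mochizuki2012, status: disputed] -/
theorem frey167_szpiroBad_7 :
    ((7 : ℝ) + 5) / 4 < (Cor22.dmod (ratPoint (((3 * 5 ^ 6 * 7 ^ 8 * 53 : ℕ) : ℚ) / (2 * 11 ^ 6 * 193 ^ 4 * 20551 : ℕ))) : ℝ) ∨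
      6 * (7 : ℕ) * (((7 : ℝ) + 5) - 4 * Cor22.dmod (ratPoint (((3 * 5 ^ 6 * 7 ^ 8 * 53 : ℕ) : ℚ) / (2 * 11 ^ 6 * 193 ^ 4 * 20551 : ℕ)))) / (((7 : ℝ) + 4) * ((7 : ℝ) - 3))
          * ((ratPoint (((3 * 5 ^ 6 * 7 ^ 8 * 53 : ℕ) : ℚ) / (2 * 11 ^ 6 * 193 ^ 4 * 20551 : ℕ))).logDiff + (1 - 1 / ((7 : ℕ) : ℝ)) * Cor22.logCondAvoid (ratPoint (((3 * 5 ^ 6 * 7 ^ 8 * 53 : ℕ) : ℚ) / (2 * 11 ^ 6 * 193 ^ 4 * 20551 : ℕ))) {2, 7})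
        + 6 * (7 : ℕ) * ((7 : ℝ) + 5) / (((7 : ℝ) + 4) * ((7 : ℝ) - 3)) * Real.log Real.pi
        < Cor22.logQAvoid (ratPoint (((3 * 5 ^ 6 * 7 ^ 8 * 53 : ℕ) : ℚ) / (2 * 11 ^ 6 * 193 ^ 4 * 20551 : ℕ))) {2, 7} :=
  szpiroBad_ratPoint_of_certificate frey167_primes frey167_exp_ne_zero frey167_D frey167_jInv frey167_N_ne_zero (l := 7)
    (by norm_num) (fun p hp _ => frey167_coprime p hp) {3, 5, 11, 53, 167, 193, 20551} (by decide) 20 35 3 (by norm_num)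
    (by norm_num) (by norm_num) (by norm_num)

/-- **Szpiro-bad at `l = 11`**: `J = I ∖ {2, 11}`, `A = 6`, `B = 9`, `n = 1` (R-W margin −30.99). [cite: Mochizuki2012, IUTchIV Thm. 1.10 p. 22–23]
[claim: Mochizuki2012, status: disputed] -/
theorem frey167_szpiroBad_11 :
    ((11 : ℝ) + 5) / 4 < (Cor22.dmod (ratPoint (((3 * 5 ^ 6 * 7 ^ 8 * 53 : ℕ) : ℚ) / (2 * 11 ^ 6 * 193 ^ 4 * 20551 : ℕ))) : ℝ) ∨
      6 * (11 : ℕ) * (((11 : ℝ) + 5) - 4 * Cor22.dmod (ratPoint (((3 * 5 ^ 6 * 7 ^ 8 * 53 : ℕ) : ℚ) / (2 * 11 ^ 6 * 193 ^ 4 * 20551 : ℕ)))) / (((11 : ℝ) + 4) * ((11 : ℝ) - 3))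
          * ((ratPoint (((3 * 5 ^ 6 * 7 ^ 8 * 53 : ℕ) : ℚ) / (2 * 11 ^ 6 * 193 ^ 4 * 20551 : ℕ))).logDiff + (1 - 1 / ((11 : ℕ) : ℝ)) * Cor22.logCondAvoid (ratPoint (((3 * 5 ^ 6 * 7 ^ 8 * 53 : ℕ) : ℚ) / (2 * 11 ^ 6 * 193 ^ 4 * 20551 : ℕ))) {2, 11})
        + 6 * (11 : ℕ) * ((11 : ℝ) + 5) / (((11 : ℝ) + 4) * ((11 : ℝ) - 3)) * Real.log Real.pi
        < Cor22.logQAvoid (ratPoint (((3 * 5 ^ 6 * 7 ^ 8 * 53 : ℕ) : ℚ) / (2 * 11 ^ 6 * 193 ^ 4 * 20551 : ℕ))) {2, 11} :=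
  szpiroBad_ratPoint_of_certificate frey167_primes frey167_exp_ne_zero frey167_D frey167_jInv frey167_N_ne_zero (l := 11)
    (by norm_num) (fun p hp _ => frey167_coprime p hp) {3, 5, 7, 53, 167, 193, 20551} (by decide) 6 9 1 (by norm_num)
    (by norm_num) (by norm_num) (by norm_num)

/-- **Szpiro-bad at `l = 13`**: `J = I ∖ {2, 13}`, `A = 6`, `B = 9`, `n = 1` (R-W margin −48.20). [cite: Mochizuki2012, IUTchIV Thm. 1.10 p. 22–23]
[claim: Mochizuki2012, status: disputed] -/
theorem frey167_szpiroBad_13 :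
    ((13 : ℝ) + 5) / 4 < (Cor22.dmod (ratPoint (((3 * 5 ^ 6 * 7 ^ 8 * 53 : ℕ) : ℚ) / (2 * 11 ^ 6 * 193 ^ 4 * 20551 : ℕ))) : ℝ) ∨
      6 * (13 : ℕ) * (((13 : ℝ) + 5) - 4 * Cor22.dmod (ratPoint (((3 * 5 ^ 6 * 7 ^ 8 * 53 : ℕ) : ℚ) / (2 * 11 ^ 6 * 193 ^ 4 * 20551 : ℕ)))) / (((13 : ℝ) + 4) * ((13 : ℝ) - 3))
          * ((ratPoint (((3 * 5 ^ 6 * 7 ^ 8 * 53 : ℕ) : ℚ) / (2 * 11 ^ 6 * 193 ^ 4 * 20551 : ℕ))).logDiff + (1 - 1 / ((13 : ℕ) : ℝ)) * Cor22.logCondAvoid (ratPoint (((3 * 5 ^ 6 * 7 ^ 8 * 53 : ℕ) : ℚ) / (2 * 11 ^ 6 * 193 ^ 4 * 20551 : ℕ))) {2, 13})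
        + 6 * (13 : ℕ) * ((13 : ℝ) + 5) / (((13 : ℝ) + 4) * ((13 : ℝ) - 3)) * Real.log Real.pi
        < Cor22.logQAvoid (ratPoint (((3 * 5 ^ 6 * 7 ^ 8 * 53 : ℕ) : ℚ) / (2 * 11 ^ 6 * 193 ^ 4 * 20551 : ℕ))) {2, 13} :=
  szpiroBad_ratPoint_of_certificate frey167_primes frey167_exp_ne_zero frey167_D frey167_jInv frey167_N_ne_zero (l := 13)
    (by norm_num) (fun p hp _ => frey167_coprime p hp) {3, 5, 7, 11, 53, 167, 193, 20551} (by decide) 6 9 1 (by norm_num)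
    (by norm_num) (by norm_num) (by norm_num)

/-! ## §4. Window membership: every datum over `(ratPoint (a/c), l)`, `l ∈ {7, 11, 13}`, is off the degree-form depth locus -/

/-- **In the window at `l ∈ {7, 11, 13}`**: every local height of `a/c` is `≤ 18` (the bad primes are all odd) and `((l⋆)²−1)·18 ≤ 2l·(4(l⋆+1)+1)`
(`144 ≤ 238`, `432 ≤ 550`, `630 ≤ 754`), so the depth antecedent of `hSHwBad` holds at EVERY genuine Θ-volume datum `T` over the point — although `h_167 = 18 > 16`
exceeds the uniform window bound of p457542, the exact top-label criterion (abc-iut-w4-d078, N₀ := l) keeps the point in the window at these `l`.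
[cite: Mochizuki2012, IUTchIV Thm. 1.10 p. 22–23] [claim: Mochizuki2012, status: disputed] -/
theorem frey167_not_deep {l : ℕ} (hl : l = 7 ∨ l = 11 ∨ l = 13) (T : Cor22.ThetaVolumeDatumAt (ratPoint (((3 * 5 ^ 6 * 7 ^ 8 * 53 : ℕ) : ℚ) / (2 * 11 ^ 6 * 193 ^ 4 * 20551 : ℕ))) l) :
    letI := T.instFieldF; letI := T.instNumberFieldF; letI := T.instAlgebraF; letI := T.instFieldK
    letI := T.instNumberFieldK; letI := T.instAlgebraK; letI := T.instFieldFbar; letI := T.instAlgebraFbar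
    letI := T.instAlgebraKFbar; letI := T.instIsElliptic
    ¬ (∃ (pp : Nat.Primes) (_ : 2 < (pp : ℕ)) (i : Fin (thetaIndex (pilotDataOfK T.D T.K)).lstar)
        (x₀ : (thetaIndex (pilotDataOfK T.D T.K)).Fibre (.inr pp)),
      haveI : Fact (pp : ℕ).Prime := ⟨pp.2⟩
      ((pp : ℕ) : ℝ) ^ ((((i : ℕ) : ℝ) + 2) * (4 + 2 * Real.logb (pp : ℕ) (Module.finrank ℚ T.K)) + 1) *
        ‖(exists_realising_qIdeles_pilotDataOfK T.D).choose pp x₀‖ ^ (((i : ℕ) + 1) ^ 2 - 1) < 1) := by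
  refine not_deep_ratPoint T fun u hu2 hneg => ?_
  have hmem := (Cor22.ord_jInv_ratPoint_neg_iff frey167_primes frey167_exp_ne_zero frey167_D frey167_jInv frey167_N_ne_zero u
    (fun h => frey167_coprime _ h)).1 hneg
  rw [Cor22.ord_jInv_ratPoint_of_mem frey167_primes frey167_D frey167_jInv frey167_N_ne_zero u hmem (frey167_coprime _ hmem)]
  push_cast
  simp only [neg_neg]
  have hp1 : 1 < Rat.HeightOneSpectrum.natGenerator u := (Rat.HeightOneSpectrum.prime_natGenerator u).one_lt
  refine topLabel_test_of_le (B := 18) hp1 (by rcases hl with rfl | rfl | rfl <;> norm_num) ?_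
    (by rcases hl with rfl | rfl | rfl <;> norm_num)
  simp only [Finset.mem_insert, Finset.mem_singleton] at hmem
  generalize Rat.HeightOneSpectrum.natGenerator u = p at hmem ⊢
  rcases hmem with rfl | rfl | rfl | rfl | rfl | rfl | rfl | rfl <;> norm_num

/-! ## §5. The APEX at `p = 167`: `hSHwBad` of p453137 is FALSE (modulo (P6) at the point) -/

/-- **APEX, `p = 167`, `l₀ ∈ {7, 11, 13}` (C-R39a's tier-2 «[ED] route» target).** ASSUMING (P6) = `Cor22.CondP6` at
`(ratPoint (3·5⁶·7⁸·53/2·11⁶·193⁴·20551), l₀)` (the image of Galois on `E[l₀]` over the theta field; NOT decided here), the binder `hSHwBad` of the cut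
certificate of record `Conditional.abc_of_SH_v10K_window_szpiroBadAll` (abc-iut-s2-p2 p453137; VERBATIM its text) is FALSE for EVERY family of the certificate's
free context binders: the point is admissible (§2) and Szpiro-bad (§3), every genuine Θ-volume datum over it is in the window (§4) and violates S_H
(abc-iut-w5-d107's [LIN] row theorem at the tame place over `167`), and a datum exists (`ThetaPartII.stub_thetaData`). Refuted-as-typed ≠ refuted-in-print;
says nothing about [IUTchIII] Cor. 3.12, `hNumBad`, the θ-cut record or abc. [cite: Mochizuki2012, IUTchIII Cor. 3.12 p. 173–174; IUTchIV Cor. 2.2 (ii)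
proof (P6)(P7) p. 46] [claim: Mochizuki2012, status: disputed] -/
theorem not_hSHwBad_frey_167 {l₀ : ℕ} (hl₀ : l₀ = 7 ∨ l₀ = 11 ∨ l₀ = 13)
    (hP6 : Cor22.CondP6 (ratPoint (((3 * 5 ^ 6 * 7 ^ 8 * 53 : ℕ) : ℚ) / (2 * 11 ^ 6 * 193 ^ 4 * 20551 : ℕ))) l₀)
    (M : ∀ (P : NFPoint) (l : ℕ) (T : Cor22.ThetaVolumeDatumAt P l), Type) [∀ P l T, Field (M P l T)] [∀ P l T, NumberField (M P l T)]
    (archPk : ∀ (P : NFPoint) (l : ℕ) (T : Cor22.ThetaVolumeDatumAt P l), letI := T.instFieldF; letI := T.instNumberFieldF; letI := T.instAlgebraF; letI := T.instFieldK;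
        letI := T.instNumberFieldK; letI := T.instAlgebraK; letI := T.instFieldFbar; letI := T.instAlgebraFbar;
        letI := T.instAlgebraKFbar; letI := T.instIsElliptic;
      ∀ (j : (thetaIndex (pilotDataOfK T.D T.K)).Label) (vQ : (thetaIndex (pilotDataOfK T.D T.K)).VQ), Set ((logShellsDH (pilotDataOfK T.D T.K) (analyticLogv T.K)).Packet j vQ))
    (archSub : ∀ (P : NFPoint) (l : ℕ) (T : Cor22.ThetaVolumeDatumAt P l), letI := T.instFieldF; letI := T.instNumberFieldF; letI := T.instAlgebraF; letI := T.instFieldK;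
        letI := T.instNumberFieldK; letI := T.instAlgebraK; letI := T.instFieldFbar; letI := T.instAlgebraFbar;
        letI := T.instAlgebraKFbar; letI := T.instIsElliptic;
      ∀ (j : (thetaIndex (pilotDataOfK T.D T.K)).Label) (v : (thetaIndex (pilotDataOfK T.D T.K)).V), Set ((logShellsDH (pilotDataOfK T.D T.K) (analyticLogv T.K)).Packet j ((thetaIndex (pilotDataOfK T.D T.K)).over v)))
    (Ψ : ∀ (P : NFPoint) (l : ℕ) (T : Cor22.ThetaVolumeDatumAt P l), letI := T.instFieldF; letI := T.instNumberFieldF; letI := T.instAlgebraF; letI := T.instFieldK;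
        letI := T.instNumberFieldK; letI := T.instAlgebraK; letI := T.instFieldFbar; letI := T.instAlgebraFbar;
        letI := T.instAlgebraKFbar; letI := T.instIsElliptic;
      ℤ → ∀ v : (thetaIndex (pilotDataOfK T.D T.K)).V, v ∈ (thetaIndex (pilotDataOfK T.D T.K)).Vbad → Set ((logShellsDH (pilotDataOfK T.D T.K) (analyticLogv T.K)).StarPacket v))
    (act : ∀ (P : NFPoint) (l : ℕ) (T : Cor22.ThetaVolumeDatumAt P l), letI := T.instFieldF; letI := T.instNumberFieldF; letI := T.instAlgebraF; letI := T.instFieldK;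
        letI := T.instNumberFieldK; letI := T.instAlgebraK; letI := T.instFieldFbar; letI := T.instAlgebraFbar;
        letI := T.instAlgebraKFbar; letI := T.instIsElliptic;
      ℤ → ∀ v : (thetaIndex (pilotDataOfK T.D T.K)).V, v ∈ (thetaIndex (pilotDataOfK T.D T.K)).Vbad → (logShellsDH (pilotDataOfK T.D T.K) (analyticLogv T.K)).StarPacket v → Module.End ℚ ((logShellsDH (pilotDataOfK T.D T.K) (analyticLogv T.K)).StarPacket v))
    (Mmod : ∀ (P : NFPoint) (l : ℕ) (T : Cor22.ThetaVolumeDatumAt P l), letI := T.instFieldF; letI := T.instNumberFieldF; letI := T.instAlgebraF; letI := T.instFieldK;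
        letI := T.instNumberFieldK; letI := T.instAlgebraK; letI := T.instFieldFbar; letI := T.instAlgebraFbar;
        letI := T.instAlgebraKFbar; letI := T.instIsElliptic;
      ℤ → ∀ j : (thetaIndex (pilotDataOfK T.D T.K)).LabelStar, Set ((logShellsDH (pilotDataOfK T.D T.K) (analyticLogv T.K)).GlobalPacket j.1))
    (region : ∀ (P : NFPoint) (l : ℕ) (T : Cor22.ThetaVolumeDatumAt P l), letI := T.instFieldF; letI := T.instNumberFieldF; letI := T.instAlgebraF; letI := T.instFieldK;
        letI := T.instNumberFieldK; letI := T.instAlgebraK; letI := T.instFieldFbar; letI := T.instAlgebraFbar;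
        letI := T.instAlgebraKFbar; letI := T.instIsElliptic;
      ℤ → ∀ j : (thetaIndex (pilotDataOfK T.D T.K)).LabelStar, FinDivisor (M P l T) → ∀ vQ : (thetaIndex (pilotDataOfK T.D T.K)).VQ, Set ((logShellsDH (pilotDataOfK T.D T.K) (analyticLogv T.K)).Packet j.1 vQ))
    (frobAdm : ∀ (P : NFPoint) (l : ℕ) (T : Cor22.ThetaVolumeDatumAt P l), letI := T.instFieldF; letI := T.instNumberFieldF; letI := T.instAlgebraF; letI := T.instFieldK;
        letI := T.instNumberFieldK; letI := T.instAlgebraK; letI := T.instFieldFbar; letI := T.instAlgebraFbar;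
        letI := T.instAlgebraKFbar; letI := T.instIsElliptic;
      ℤ → ℤ → ∀ (j : (thetaIndex (pilotDataOfK T.D T.K)).Label) (vQ : (thetaIndex (pilotDataOfK T.D T.K)).VQ), Set ((logShellsDH (pilotDataOfK T.D T.K) (analyticLogv T.K)).Packet j vQ) → Prop)
    (frobLogvol : ∀ (P : NFPoint) (l : ℕ) (T : Cor22.ThetaVolumeDatumAt P l), letI := T.instFieldF; letI := T.instNumberFieldF; letI := T.instAlgebraF; letI := T.instFieldK;
        letI := T.instNumberFieldK; letI := T.instAlgebraK; letI := T.instFieldFbar; letI := T.instAlgebraFbar;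
        letI := T.instAlgebraKFbar; letI := T.instIsElliptic;
      ℤ → ℤ → ∀ (j : (thetaIndex (pilotDataOfK T.D T.K)).Label) (vQ : (thetaIndex (pilotDataOfK T.D T.K)).VQ), Set ((logShellsDH (pilotDataOfK T.D T.K) (analyticLogv T.K)).Packet j vQ) → ℝ)
    (frobΨ : ∀ (P : NFPoint) (l : ℕ) (T : Cor22.ThetaVolumeDatumAt P l), letI := T.instFieldF; letI := T.instNumberFieldF; letI := T.instAlgebraF; letI := T.instFieldK;
        letI := T.instNumberFieldK; letI := T.instAlgebraK; letI := T.instFieldFbar; letI := T.instAlgebraFbar;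
        letI := T.instAlgebraKFbar; letI := T.instIsElliptic;
      ℤ → ℤ → ∀ v : (thetaIndex (pilotDataOfK T.D T.K)).V, v ∈ (thetaIndex (pilotDataOfK T.D T.K)).Vbad → Set ((logShellsDH (pilotDataOfK T.D T.K) (analyticLogv T.K)).StarPacket v))
    (frobMmod : ∀ (P : NFPoint) (l : ℕ) (T : Cor22.ThetaVolumeDatumAt P l), letI := T.instFieldF; letI := T.instNumberFieldF; letI := T.instAlgebraF; letI := T.instFieldK;
        letI := T.instNumberFieldK; letI := T.instAlgebraK; letI := T.instFieldFbar; letI := T.instAlgebraFbar;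
        letI := T.instAlgebraKFbar; letI := T.instIsElliptic;
      ℤ → ℤ → ∀ j : (thetaIndex (pilotDataOfK T.D T.K)).LabelStar, Set ((logShellsDH (pilotDataOfK T.D T.K) (analyticLogv T.K)).GlobalPacket j.1))
    (unitImage : ∀ (P : NFPoint) (l : ℕ) (T : Cor22.ThetaVolumeDatumAt P l), letI := T.instFieldF; letI := T.instNumberFieldF; letI := T.instAlgebraF; letI := T.instFieldK;
        letI := T.instNumberFieldK; letI := T.instAlgebraK; letI := T.instFieldFbar; letI := T.instAlgebraFbar;
        letI := T.instAlgebraKFbar; letI := T.instIsElliptic;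
      ℤ → ℤ → ℕ → ∀ (j : (thetaIndex (pilotDataOfK T.D T.K)).Label) (vQ : (thetaIndex (pilotDataOfK T.D T.K)).VQ), Set ((logShellsDH (pilotDataOfK T.D T.K) (analyticLogv T.K)).Packet j vQ))
    (ballImage : ∀ (P : NFPoint) (l : ℕ) (T : Cor22.ThetaVolumeDatumAt P l), letI := T.instFieldF; letI := T.instNumberFieldF; letI := T.instAlgebraF; letI := T.instFieldK;
        letI := T.instNumberFieldK; letI := T.instAlgebraK; letI := T.instFieldFbar; letI := T.instAlgebraFbar;
        letI := T.instAlgebraKFbar; letI := T.instIsElliptic;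
      ℤ → ℤ → ∀ (j : (thetaIndex (pilotDataOfK T.D T.K)).Label) (vQ : (thetaIndex (pilotDataOfK T.D T.K)).VQ), Set ((logShellsDH (pilotDataOfK T.D T.K) (analyticLogv T.K)).Packet j vQ))
    (thetaDiv : ∀ (P : NFPoint) (l : ℕ) (T : Cor22.ThetaVolumeDatumAt P l), letI := T.instFieldF; letI := T.instNumberFieldF; letI := T.instAlgebraF; letI := T.instFieldK;
        letI := T.instNumberFieldK; letI := T.instAlgebraK; letI := T.instFieldFbar; letI := T.instAlgebraFbar;
        letI := T.instAlgebraKFbar; letI := T.instIsElliptic;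
      ℤ → ℤ → LgpDivisor (M P l T) (thetaIndex (pilotDataOfK T.D T.K)).lstar)
    (n : ∀ (P : NFPoint) (l : ℕ) (T : Cor22.ThetaVolumeDatumAt P l), ℤ)
    {HT : ∀ (P : NFPoint) (l : ℕ) (T : Cor22.ThetaVolumeDatumAt P l), Type} {LogLink : ∀ (P : NFPoint) (l : ℕ) (T : Cor22.ThetaVolumeDatumAt P l), HT P l T → HT P l T → Type}
    {IsFull : ∀ (P : NFPoint) (l : ℕ) (T : Cor22.ThetaVolumeDatumAt P l), ∀ {s t : HT P l T}, LogLink P l T s t → Prop}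
    (lat : ∀ (P : NFPoint) (l : ℕ) (T : Cor22.ThetaVolumeDatumAt P l), LGPGaussianLogThetaLattice (LogLink P l T) (IsFull P l T))
    {Frd : ∀ (P : NFPoint) (l : ℕ) (T : Cor22.ThetaVolumeDatumAt P l), Type} {IsoF : ∀ (P : NFPoint) (l : ℕ) (T : Cor22.ThetaVolumeDatumAt P l), Frd P l T → Frd P l T → Type} {Ob : ∀ (P : NFPoint) (l : ℕ) (T : Cor22.ThetaVolumeDatumAt P l), Frd P l T → Type}
    {realify : ∀ (P : NFPoint) (l : ℕ) (T : Cor22.ThetaVolumeDatumAt P l), Frd P l T → Frd P l T} {Strip : ∀ (P : NFPoint) (l : ℕ) (T : Cor22.ThetaVolumeDatumAt P l), Type} {IsoS : ∀ (P : NFPoint) (l : ℕ) (T : Cor22.ThetaVolumeDatumAt P l), Strip P l T → Strip P l T → Type}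
    {Mv : ∀ (P : NFPoint) (l : ℕ) (T : Cor22.ThetaVolumeDatumAt P l), letI := T.instFieldF; letI := T.instNumberFieldF; letI := T.instAlgebraF; letI := T.instFieldK;
        letI := T.instNumberFieldK; letI := T.instAlgebraK; letI := T.instFieldFbar; letI := T.instAlgebraFbar;
        letI := T.instAlgebraKFbar; letI := T.instIsElliptic;
      ∀ v : (thetaIndex (pilotDataOfK T.D T.K)).V, v ∈ (thetaIndex (pilotDataOfK T.D T.K)).Vbad → Type}
    [∀ P l T v h, Monoid (Mv P l T v h)]
    (sig : ∀ (P : NFPoint) (l : ℕ) (T : Cor22.ThetaVolumeDatumAt P l), letI := T.instFieldF; letI := T.instNumberFieldF; letI := T.instAlgebraF; letI := T.instFieldK;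
        letI := T.instNumberFieldK; letI := T.instAlgebraK; letI := T.instFieldFbar; letI := T.instAlgebraFbar;
        letI := T.instAlgebraKFbar; letI := T.instIsElliptic;
      GlobalLGPFrobenioidSignature (thetaIndex (pilotDataOfK T.D T.K)).lstar (thetaIndex (pilotDataOfK T.D T.K)).V (· ∈ (thetaIndex (pilotDataOfK T.D T.K)).Vbad) (Frd P l T) (IsoF P l T) (Ob P l T) (realify P l T)
        (Strip P l T) (IsoS P l T) (Mv P l T))
    (split : ∀ (P : NFPoint) (l : ℕ) (T : Cor22.ThetaVolumeDatumAt P l), SplittingMonoids (Mv P l T))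
    {ObΔ : ∀ (P : NFPoint) (l : ℕ) (T : Cor22.ThetaVolumeDatumAt P l), Type} {N : ∀ (P : NFPoint) (l : ℕ) (T : Cor22.ThetaVolumeDatumAt P l), letI := T.instFieldF; letI := T.instNumberFieldF; letI := T.instAlgebraF; letI := T.instFieldK;
        letI := T.instNumberFieldK; letI := T.instAlgebraK; letI := T.instFieldFbar; letI := T.instAlgebraFbar;
        letI := T.instAlgebraKFbar; letI := T.instIsElliptic;
      ∀ v : (thetaIndex (pilotDataOfK T.D T.K)).V, v ∈ (thetaIndex (pilotDataOfK T.D T.K)).Vbad → Type}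
    [∀ P l T v h, Monoid (N P l T v h)] (qData : ∀ (P : NFPoint) (l : ℕ) (T : Cor22.ThetaVolumeDatumAt P l), QPilotData (ObΔ P l T) (N P l T))
    (qK : ∀ (P : NFPoint) (l : ℕ) (T : Cor22.ThetaVolumeDatumAt P l), letI := T.instFieldF; letI := T.instNumberFieldF; letI := T.instAlgebraF; letI := T.instFieldK;
        letI := T.instNumberFieldK; letI := T.instAlgebraK; letI := T.instFieldFbar; letI := T.instAlgebraFbar;
        letI := T.instAlgebraKFbar; letI := T.instIsElliptic;
      ∀ v : (thetaIndex (pilotDataOfK T.D T.K)).V, v ∈ (thetaIndex (pilotDataOfK T.D T.K)).Vbad → Set ((logShellsDH (pilotDataOfK T.D T.K) (analyticLogv T.K)).StarPacket v)) :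
    ¬ (∀ (P : NFPoint), P ∈ UP → ∀ (l : ℕ), l.Prime → 5 ≤ l →
      Cor22.AdmitsCore P → Cor22.CondP2 P l → Cor22.CondP5 P l → Cor22.CondP6 P l →
      -- ONLY at SZPIRO-BAD `(P, l)`: elsewhere `T.Cor312Of` is the theorem `Cor22.ThetaVolumeDatumAt.cor312Of_of_szpiro` (abc-iut-c312-d1)
      (((l : ℝ) + 5) / 4 < (Cor22.dmod P : ℝ) ∨
        6 * l * (((l : ℝ) + 5) - 4 * Cor22.dmod P) / (((l : ℝ) + 4) * ((l : ℝ) - 3))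
            * (P.logDiff + (1 - 1 / (l : ℝ)) * Cor22.logCondAvoid P {2, l})
          + 6 * l * ((l : ℝ) + 5) / (((l : ℝ) + 4) * ((l : ℝ) - 3)) * Real.log Real.pi < Cor22.logQAvoid P {2, l}) →
      ∀ (T : Cor22.ThetaVolumeDatumAt P l), letI := T.instFieldF; letI := T.instNumberFieldF; letI := T.instAlgebraF; letI := T.instFieldK;
        letI := T.instNumberFieldK; letI := T.instAlgebraK; letI := T.instFieldFbar; letI := T.instAlgebraFbar;
        letI := T.instAlgebraKFbar; letI := T.instIsElliptic;
      ¬ (∃ (pp : Nat.Primes) (_ : 2 < (pp : ℕ)) (i : Fin (thetaIndex (pilotDataOfK T.D T.K)).lstar)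
          (x₀ : (thetaIndex (pilotDataOfK T.D T.K)).Fibre (.inr pp)),
        haveI : Fact (pp : ℕ).Prime := ⟨pp.2⟩
        ((pp : ℕ) : ℝ) ^ ((((i : ℕ) : ℝ) + 2) * (4 + 2 * Real.logb (pp : ℕ) (Module.finrank ℚ T.K)) + 1) *
          ‖(exists_realising_qIdeles_pilotDataOfK T.D).choose pp x₀‖ ^ (((i : ℕ) + 1) ^ 2 - 1) < 1) →
      Cor312Vol.PilotKummerCompatHull
        (LatticeSituation.ofShells (logShellsDH (pilotDataOfK T.D T.K) (analyticLogv T.K)) (M P l T) (archPk P l T)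
          (archSub P l T) (summandPiecesPr (pilotDataOfK T.D T.K) (logvAnalytic_analyticLogv (F := T.K))).Adm
          (summandPiecesPr (pilotDataOfK T.D T.K) (logvAnalytic_analyticLogv (F := T.K))).logvol (Ψ P l T) (act P l T) (Mmod P l T)
          (region P l T) (frobAdm P l T) (frobLogvol P l T) (frobΨ P l T) (frobMmod P l T) (unitImage P l T)
          (ballImage P l T) (thetaDiv P l T))
        (settingPrVolSharp (pilotDataOfK T.D T.K) (logvAnalytic_analyticLogv (F := T.K)) (M P l T) (archPk P l T) (archSub P l T) (Ψ P l T)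
          (act P l T) (Mmod P l T) (region P l T) (n P l T) (lat P l T) (sig P l T) (split P l T) (qData P l T)
          (exists_realising_qIdeles_pilotDataOfK T.D).choose
          (exists_realising_thetaIdeles_pilotDataOfK T.D).choose
          (exists_realising_qIdeles_pilotDataOfK T.D).choose_spec.1
          (exists_realising_qIdeles_pilotDataOfK T.D).choose_spec.2.1)
        (fun _ => Cor312.Setting.qRegion
        (settingPrVolSharp (pilotDataOfK T.D T.K) (logvAnalytic_analyticLogv (F := T.K)) (M P l T) (archPk P l T) (archSub P l T) (Ψ P l T)
          (act P l T) (Mmod P l T) (region P l T) (n P l T) (lat P l T) (sig P l T) (split P l T) (qData P l T)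
          (exists_realising_qIdeles_pilotDataOfK T.D).choose
          (exists_realising_thetaIdeles_pilotDataOfK T.D).choose
          (exists_realising_qIdeles_pilotDataOfK T.D).choose_spec.1
          (exists_realising_qIdeles_pilotDataOfK T.D).choose_spec.2.1)) (qK P l T)) := by
  have hl₀p : l₀.Prime := by rcases hl₀ with rfl | rfl | rfl <;> norm_num
  have h5 : 5 ≤ l₀ := by rcases hl₀ with rfl | rfl | rfl <;> norm_num
  have hne : 167 ≠ l₀ := by rcases hl₀ with rfl | rfl | rfl <;> norm_num
  have hl' : l₀ = 7 ∨ l₀ = 11 ∨ l₀ = 13 ∨ l₀ = 53 := by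
    rcases hl₀ with h | h | h
    · exact Or.inl h
    · exact Or.inr (Or.inl h)
    · exact Or.inr (Or.inr (Or.inl h))
  refine not_hSHwBad_of_row frey167_mem_UP hl₀p h5 frey167_admitsCore (frey167_condP2 hl₀) (frey167_condP5 hl₀p hne) hP6
    ?_ (frey167_not_deep hl₀) (fun T => GenuineK.not_pilotKummerCompatHull_chosen_frey14321927484375 hl' T) M archPk archSub Ψ act Mmod
    region frobAdm frobLogvol frobΨ frobMmod unitImage ballImage thetaDiv n lat sig split qData qK
  rcases hl₀ with rfl | rfl | rfl
  · exact frey167_szpiroBad_7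
  · exact frey167_szpiroBad_11
  · exact frey167_szpiroBad_13

end FreyRef

end Summit.ABC.IUTFork.Conditional

end
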